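import Literature.MathematicalPhysics.QuantumFieldTheory.Balaban1983to89.B13Sect1Arith

/-!
# NE9Lemma1Gather — the E₀-free nested sums (1.24)×(1.25), (1.26)–(1.28) of [II] p. 8 AT ONE CREATION STEP
# (`B13Sect1Arith.gather_129` without its j-level: the factor L^jη KEPT), for leaf S5 of the NE9 frame
# (cell `pub-balaban`, T4-DAG §2 node U3 / §6 NE9; lineage t4-ne9-p1 = row NE9 OWNER, generation 23; part 1 of 3)

HONEST FRAMING (T4-DAG PAGE 1).  Rung (B)+1 of the FINITE-VOLUME T⁴ programme — NOT infinite volume, NOT a mass gap, NOT the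
Clay problem.  NE9 (`T4OutputRate.NE9` ∧ `FadingMemory`) is a cell NEW ESTIMATE, NOT PRINTED, NOT discharged here; spine 0/9.
HONEST DEPENDENCY (cell line, verbatim): continuum YM on T⁴ ⇐ BetaPertH ∧ nine spine estimates (0/9 proved); BetaPertH ⇐ (D1)
∧ (D4) ∧ CAP+tail; G-an2-4 gates asym, D1 and NE2/3/4.  `FlowStep.BetaPertH`, (B), (B^μ) do not occur.  [II] =
[Balaban1988RG2Cluster] is quoted for TYPES only (ABSOLUTE RULE: nothing printed in the audited series is asserted).

WHY.  Leaf S5 of the NE9 skeleton (`t4/b2b-balaban-t4-ne9-p1/SKELETON-NE9-P1.md` v1.3.3 §3) — the PER-CREATION-STEP size bound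
of the localization channel, `T4HistoryLipschitzRecursion.ChannelSizeAtStepNN … wt τ` with `τ k j ≤ τ̄·ω^{k−j}`, the ONLY source
of NE9's fading factor — has the printed TYPE "[II] Lemma 1 read BEFORE the sum over the creation step j" (p. 8 l. 9–10:
*"This yields (6L)⁴L^jη, and the sum over j is bounded by 2(6L)⁴"*).  The arithmetic of Lemma 1's proof is kernel-certified in
the tree module `B13Sect1Arith` (unit pv20) — but its gathering theorem `gather_129` performs the sum over j inside and
returns print's j-free (1.29).  This file re-runs that gathering at ONE creation step, so that the factor `ℓ = L^jη` survives:
* `sum_le_sum_sum_of_cover` — the □′-device of p. 8 l. 1–4 (a sum over sources covered by fibres ≤ the double sum);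
* **`gather_atStep`** — □₀ ∈ `S0`, Y₀ ∈ `SY □₀`, □′ ∈ `Sq □₀ Y₀`, X ∈ `SX □₀ Y₀ □′`, terms ≤ the (1.24)×(1.25) shape
  `K·ℓ⁵·e^{−κd_j(X)}·exp(−⅛(κ₁−1)d + ⅛κ₁d₀ − ½(κ₁−1)n)`, level bounds (1.26) `hX`, □′-count `hq`, (1.27) `hY`, (1.28) `h0` AS
  HYPOTHESES exactly as in `gather_129` ⟹ sum ≤ `K·O1·((6L)⁴·ℓ)·e·exp(⅛κ₁d₀)·exp(−(1/16)κ₁d)`;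
* `gather_129_of_atStep` — summing over j ≤ k with ℓ_j = L^j(L^k)⁻¹, L ≥ 2, recovers print's constant 2(6L)⁴ (`B13Sect1Arith.jsum_le`).
Consumers: `Support/NE9Lemma1Counting` (the S5 binder for channels of the (1.23)/(1.33)-piece form) and
`Support/NE9Lemma1CountingEval` (the junction with P2's `NE9EvaluationChannel`).  Pure real arithmetic over abstract finite
index sets; the numerals (6L)⁴, 8·12³, 3·2³ are the paper's counts, not verified (as in `gather_129`).

References (TYPES only): T. Bałaban, *Renormalization group approach to lattice gauge field theories. II. Cluster expansions*,
Commun. Math. Phys. **116**, 1–22 (1988) [Balaban1988RG2Cluster], (1.24)–(1.29) pp. 7–8 (renders `b2b-balaban-ref1/pages/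
1988-cmp116-rg-II-cluster/…-p007/p008-x2.png` re-read as images by this seat, 2026-08-20).  Summits-side NEW work (LEAN PLACEMENT
RULE); imports the tree's `B13Sect1Arith` (`sum_le_card_mul`, `exponent_129`, `jsum_le` BY NAME); modifies nothing; 0 sorry.
Value = kernel bookkeeping, NOT summit progress.
-/

noncomputable section

namespace Summit.QuantumFields.BalabanUV.T4Continuum.NE9Lemma1Gather

open scoped BigOperators
open Literature.MathematicalPhysics.QuantumFieldTheory.Balaban1983to89

/-! ## §0 Two elementary summation facts -/

/-- Sums of a nonnegative function over a union are at most the sum of the two sums. [folklore] -/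
theorem sum_union_le_of_nonneg {δ : Type*} [DecidableEq δ] (s t : Finset δ) (f : δ → ℝ) (hf : ∀ x, 0 ≤ f x) :
    ∑ x ∈ s ∪ t, f x ≤ ∑ x ∈ s, f x + ∑ x ∈ t, f x := by
  have h := Finset.sum_union_inter (s₁ := s) (s₂ := t) (f := f)
  have h2 : 0 ≤ ∑ x ∈ s ∩ t, f x := Finset.sum_nonneg fun x _ => hf x
  linarith

/-- THE □′-DEVICE of [II] p. 8 l. 1–4 (*"This sum can be bounded by two sums, the first is over □′∈π_j, □′ ⊂ □̃², the second
over X∈𝐃_j such that □′ ⊂ X"*): a sum of NONNEGATIVE terms over a family of sources each of which lies in some fibre `SX q`,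
`q ∈ Sq`, is at most the double sum over the fibres (sources lying over several □′ are over-counted).
[cite: Balaban1988RG2Cluster, (1.26) p.8] -/
theorem sum_le_sum_sum_of_cover {γ δ : Type*} (S : Finset δ) (Sq : Finset γ) (SX : γ → Finset δ)
    (f : δ → ℝ) (hf : ∀ x, 0 ≤ f x) (hcover : ∀ x ∈ S, ∃ q ∈ Sq, x ∈ SX q) :
    ∑ x ∈ S, f x ≤ ∑ q ∈ Sq, ∑ x ∈ SX q, f x := by
  classical
  have hsub : S ⊆ Sq.biUnion SX := fun x hx => Finset.mem_biUnion.mpr (hcover x hx)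
  have h1 : ∑ x ∈ S, f x ≤ ∑ x ∈ Sq.biUnion SX, f x :=
    Finset.sum_le_sum_of_subset_of_nonneg hsub fun x _ _ => hf x
  refine h1.trans ?_
  clear h1 hsub hcover
  induction Sq using Finset.induction_on with
  | empty => simp
  | insert q Sq hq ih =>
    rw [Finset.biUnion_insert, Finset.sum_insert hq]
    exact (sum_union_le_of_nonneg _ _ f hf).trans (by linarith)

/-! ## §1 The nested sums of [II] p. 8 AT ONE CREATION STEP (`B13Sect1Arith.gather_129` without the j-level) -/

/-- **(1.24)×(1.25) summed over X, □′, Y₀, □₀ AT ONE CREATION STEP j** — the bookkeeping of [II] p. 8 *"Gathering together the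
above bounds"* kernel-checked over abstract finite index sets WITHOUT the sum over the creation step: □₀ ∈ `S0`, Y₀ ∈ `SY □₀`,
□′ ∈ `Sq □₀ Y₀`, X ∈ `SX □₀ Y₀ □′`, terms bounded pointwise by the (1.24)×(1.25) shape (`hT`: K ↔ 8B₀C₁e^{16κ₁}α₂⁻¹g_k|B|E₀(α₁/α₃)⁵,
`ℓ` ↔ L^jη, the exponential of (1.25) with d ↔ d_k(Y), d0 ↔ d_k(□₀), `n □₀ Y₀` ↔ M⁻⁴|Y₀∖□̃⁴|), and the level bounds exactly as the
text states them and exactly as `B13Sect1Arith.gather_129` takes them: (1.26) `hX` (*"Σ_{X∈𝐃_j,X⊃□′} exp(−κd_j(X)) ≦ O(1)"*), the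
□′-count `hq` (*"This yields (6L)⁴L^jη"*), (1.27) `hY` (kernel for the printed count: `B13Sect1Arith.bound_127`), (1.28) `h0`
(kernel: `B13Sect1Arith.bound_128_printed` / `_repaired`).  CONCLUSION: the sum is ≤ K·O1·((6L)⁴·ℓ)·e·exp(⅛κ₁d0)·exp(−(1/16)κ₁d)
— the factor ℓ = L^jη of p. 8 l. 9–10 KEPT.  The families may depend on the outer indices (harmless generality).
[cite: Balaban1988RG2Cluster, (1.24)-(1.29) pp.7-8] -/
theorem gather_atStep {α β γ δ : Type*} (S0 : Finset α) (SY : α → Finset β) (Sq : α → β → Finset γ)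
    (SX : α → β → γ → Finset δ) (T : α → β → γ → δ → ℝ) (ℓ : ℝ) (dj : δ → ℝ) (n : α → β → ℝ)
    {K O1 L d d0 κ κ₁ : ℝ} (hK : 0 ≤ K) (hO1 : 0 ≤ O1) (hℓ : 0 ≤ ℓ)
    (hT : ∀ a ∈ S0, ∀ y ∈ SY a, ∀ q ∈ Sq a y, ∀ x ∈ SX a y q,
      T a y q x ≤ K * ℓ ^ 5 * Real.exp (-(κ * dj x)) *
        Real.exp (-(1 / 8) * (κ₁ - 1) * d + (1 / 8) * κ₁ * d0 - (1 / 2) * (κ₁ - 1) * n a y))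
    (hX : ∀ a ∈ S0, ∀ y ∈ SY a, ∀ q ∈ Sq a y, ∑ x ∈ SX a y q, Real.exp (-(κ * dj x)) ≤ O1)
    (hq : ∀ a ∈ S0, ∀ y ∈ SY a, ((Sq a y).card : ℝ) * ℓ ^ 5 ≤ (6 * L) ^ 4 * ℓ)
    (hY : ∀ a ∈ S0, ∑ y ∈ SY a, Real.exp (-(1 / 2) * (κ₁ - 1) * n a y) ≤ Real.exp 1)
    (h0 : (S0.card : ℝ) ≤ Real.exp ((1 / 16) * (κ₁ - 2) * d)) :
    ∑ a ∈ S0, ∑ y ∈ SY a, ∑ q ∈ Sq a y, ∑ x ∈ SX a y q, T a y q x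
      ≤ K * O1 * ((6 * L) ^ 4 * ℓ) * Real.exp 1 * Real.exp ((1 / 8) * κ₁ * d0) *
        Real.exp (-(1 / 16) * κ₁ * d) := by
  -- abbreviation for the Y₀-independent part of the (1.25) exponential
  set A := Real.exp (-(1 / 8) * (κ₁ - 1) * d + (1 / 8) * κ₁ * d0) with hA
  have hA0 : 0 < A := Real.exp_pos _
  have hsplit : ∀ a y, Real.exp (-(1 / 8) * (κ₁ - 1) * d + (1 / 8) * κ₁ * d0 - (1 / 2) * (κ₁ - 1) * n a y)
      = A * Real.exp (-(1 / 2) * (κ₁ - 1) * n a y) := by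
    intro a y; rw [hA, ← Real.exp_add]; ring_nf
  -- level X : (1.26)
  have hLX : ∀ a ∈ S0, ∀ y ∈ SY a, ∀ q ∈ Sq a y,
      ∑ x ∈ SX a y q, T a y q x ≤ K * ℓ ^ 5 * O1 * (A * Real.exp (-(1 / 2) * (κ₁ - 1) * n a y)) := by
    intro a ha y hy q hq'
    calc ∑ x ∈ SX a y q, T a y q x
        ≤ ∑ x ∈ SX a y q, K * ℓ ^ 5 * Real.exp (-(κ * dj x)) * (A * Real.exp (-(1 / 2) * (κ₁ - 1) * n a y)) :=
          Finset.sum_le_sum fun x hx => by rw [← hsplit]; exact hT a ha y hy q hq' x hx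
      _ = K * ℓ ^ 5 * (A * Real.exp (-(1 / 2) * (κ₁ - 1) * n a y)) * ∑ x ∈ SX a y q, Real.exp (-(κ * dj x)) := by
          rw [Finset.mul_sum]; exact Finset.sum_congr rfl fun x _ => by ring
      _ ≤ K * ℓ ^ 5 * (A * Real.exp (-(1 / 2) * (κ₁ - 1) * n a y)) * O1 :=
          mul_le_mul_of_nonneg_left (hX a ha y hy q hq')
            (mul_nonneg (mul_nonneg hK (pow_nonneg hℓ 5)) (by positivity))
      _ = _ := by ring
  -- level □′ : the count "(6L)⁴L^jη"
  have hLq : ∀ a ∈ S0, ∀ y ∈ SY a,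
      ∑ q ∈ Sq a y, ∑ x ∈ SX a y q, T a y q x
        ≤ K * O1 * ((6 * L) ^ 4 * ℓ) * (A * Real.exp (-(1 / 2) * (κ₁ - 1) * n a y)) := by
    intro a ha y hy
    calc ∑ q ∈ Sq a y, ∑ x ∈ SX a y q, T a y q x
        ≤ (Sq a y).card * (K * ℓ ^ 5 * O1 * (A * Real.exp (-(1 / 2) * (κ₁ - 1) * n a y))) :=
          B13Sect1Arith.sum_le_card_mul _ _ _ fun q hq' => hLX a ha y hy q hq'
      _ = K * O1 * (((Sq a y).card : ℝ) * ℓ ^ 5) * (A * Real.exp (-(1 / 2) * (κ₁ - 1) * n a y)) := by ring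
      _ ≤ K * O1 * ((6 * L) ^ 4 * ℓ) * (A * Real.exp (-(1 / 2) * (κ₁ - 1) * n a y)) :=
          mul_le_mul_of_nonneg_right (mul_le_mul_of_nonneg_left (hq a ha y hy) (mul_nonneg hK hO1)) (by positivity)
  -- level Y₀ : (1.27)
  have hL6 : (0:ℝ) ≤ (6 * L) ^ 4 * ℓ := mul_nonneg (by positivity) hℓ
  have hLY : ∀ a ∈ S0, ∑ y ∈ SY a, ∑ q ∈ Sq a y, ∑ x ∈ SX a y q, T a y q x
      ≤ K * O1 * ((6 * L) ^ 4 * ℓ) * A * Real.exp 1 := by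
    intro a ha
    calc ∑ y ∈ SY a, ∑ q ∈ Sq a y, ∑ x ∈ SX a y q, T a y q x
        ≤ ∑ y ∈ SY a, K * O1 * ((6 * L) ^ 4 * ℓ) * (A * Real.exp (-(1 / 2) * (κ₁ - 1) * n a y)) :=
          Finset.sum_le_sum fun y hy => hLq a ha y hy
      _ = K * O1 * ((6 * L) ^ 4 * ℓ) * A * ∑ y ∈ SY a, Real.exp (-(1 / 2) * (κ₁ - 1) * n a y) := by
          rw [Finset.mul_sum]; exact Finset.sum_congr rfl fun y _ => by ring
      _ ≤ K * O1 * ((6 * L) ^ 4 * ℓ) * A * Real.exp 1 :=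
          mul_le_mul_of_nonneg_left (hY a ha) (mul_nonneg (mul_nonneg (mul_nonneg hK hO1) hL6) hA0.le)
  -- level □₀ : (1.28) and the exponent identity −⅛(κ₁−1)d + (1/16)(κ₁−2)d = −(1/16)κ₁d
  have hP : 0 ≤ K * O1 * ((6 * L) ^ 4 * ℓ) * A * Real.exp 1 :=
    mul_nonneg (mul_nonneg (mul_nonneg (mul_nonneg hK hO1) hL6) hA0.le) (Real.exp_pos _).le
  calc ∑ a ∈ S0, ∑ y ∈ SY a, ∑ q ∈ Sq a y, ∑ x ∈ SX a y q, T a y q x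
      ≤ S0.card * (K * O1 * ((6 * L) ^ 4 * ℓ) * A * Real.exp 1) := B13Sect1Arith.sum_le_card_mul _ _ _ hLY
    _ ≤ Real.exp ((1 / 16) * (κ₁ - 2) * d) * (K * O1 * ((6 * L) ^ 4 * ℓ) * A * Real.exp 1) :=
        mul_le_mul_of_nonneg_right h0 hP
    _ = K * O1 * ((6 * L) ^ 4 * ℓ) * Real.exp 1 * (A * Real.exp ((1 / 16) * (κ₁ - 2) * d)) := by ring
    _ = _ := by rw [hA, B13Sect1Arith.exponent_129]; ring

/-- **CONSISTENCY WITH PRINT's j-SUMMED (1.29)**: summing `gather_atStep`'s bound over the creation steps j ≤ k with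
ℓ_j = L^jη = L^j·(L^k)⁻¹ and L ≥ 2 gives the constant 2(6L)⁴ of p. 8 (*"and the sum over j is bounded by 2(6L)⁴"*,
kernel `B13Sect1Arith.jsum_le`) — the shape of `B13Sect1Arith.gather_129`. [cite: Balaban1988RG2Cluster, (1.29) p.8] -/
theorem gather_129_of_atStep {K O1 L d0 d κ₁ : ℝ} (hK : 0 ≤ K) (hO1 : 0 ≤ O1) (hL : 2 ≤ L) (k : ℕ) (V : ℕ → ℝ)
    (hV : ∀ j ∈ Finset.range (k + 1),
      V j ≤ K * O1 * ((6 * L) ^ 4 * (L ^ j * (L ^ k)⁻¹)) * Real.exp 1 * Real.exp ((1 / 8) * κ₁ * d0) *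
        Real.exp (-(1 / 16) * κ₁ * d)) :
    ∑ j ∈ Finset.range (k + 1), V j
      ≤ K * O1 * (2 * (6 * L) ^ 4) * Real.exp 1 * Real.exp ((1 / 8) * κ₁ * d0) * Real.exp (-(1 / 16) * κ₁ * d) := by
  have hj := B13Sect1Arith.jsum_le hL k
  have hP : 0 ≤ K * O1 * Real.exp 1 * Real.exp ((1 / 8) * κ₁ * d0) * Real.exp (-(1 / 16) * κ₁ * d) :=
    mul_nonneg (mul_nonneg (mul_nonneg (mul_nonneg hK hO1) (Real.exp_pos _).le) (Real.exp_pos _).le)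
      (Real.exp_pos _).le
  calc ∑ j ∈ Finset.range (k + 1), V j
      ≤ ∑ j ∈ Finset.range (k + 1), K * O1 * ((6 * L) ^ 4 * (L ^ j * (L ^ k)⁻¹)) * Real.exp 1 *
          Real.exp ((1 / 8) * κ₁ * d0) * Real.exp (-(1 / 16) * κ₁ * d) := Finset.sum_le_sum hV
    _ = K * O1 * Real.exp 1 * Real.exp ((1 / 8) * κ₁ * d0) * Real.exp (-(1 / 16) * κ₁ * d) *
          ∑ j ∈ Finset.range (k + 1), (6 * L) ^ 4 * (L ^ j * (L ^ k)⁻¹) := by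
        rw [Finset.mul_sum]; exact Finset.sum_congr rfl fun j _ => by ring
    _ ≤ K * O1 * Real.exp 1 * Real.exp ((1 / 8) * κ₁ * d0) * Real.exp (-(1 / 16) * κ₁ * d) * (2 * (6 * L) ^ 4) :=
        mul_le_mul_of_nonneg_left hj hP
    _ = _ := by ring

end Summit.QuantumFields.BalabanUV.T4Continuum.NE9Lemma1Gather
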